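import Literature.Algebra.Polynomial.LaguerreCrossSequence
import Mathlib.RingTheory.PowerSeries.Derivative
import Mathlib.Tactic
import HarnessLib

/-!
# Generators of cross-sequences: `e^{(F+G)(D)} = e^{F(D)} e^{G(D)}` and Proposition 6 (a) (Rota–Kahaner–Odlyzko §8)

G.-C. Rota, D. Kahaner, A. Odlyzko, *Finite operator calculus* (1973), §8, pp. 715–716:

> Every invertible shift-invariant operator `P` can be written in the form `P = e^F` for some
> shift-invariant operator (which is never invertible) … Thus `P^{−λ} = exp (−λF)`. Note that `F` is
> not necessarily a delta operator, though `F 1 = 0`. We call `F` the *generator* of the cross-sequence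
> `p_n^{[λ]} (x)`. Thus, an operator `F` is the generator of a necessarily unique cross-sequence of
> polynomials, if and only if `F (1) = 0`.
> **Proposition 6.** (a) If `F` and `G` are the generators of cross-sequences `p_n^{[λ]} (x)` and
> `q_n^{[λ]} (x)` having the same basic sequence, then `F + G` is the generator of the cross-sequence
> `e^{−λG} p_n^{[λ]} (x) = e^{−λF} q_n^{[λ]} (x)`. (b) …

The content of (a) is the functional equation of the exponential series under SUBSTITUTION,
`e^{A+B} = e^{A} e^{B}` for `A, B ∈ tK[[t]]` — which Mathlib has only in the rescaling form
`e^{at} e^{bt} = e^{(a+b)t}` (`PowerSeries.exp_mul_exp_eq_exp_add`). We prove it by the uniqueness of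
solutions of `f′ = u f`, `f (0) = 1` in characteristic `0` (`eq_of_derivative_eq_mul`,
`exp_subst_add`), and deduce: `expOp (F + G) a = expOp F a ∘ expOp G a` (`expOp_add_generator`),
Proposition 6 (a) (`expOp_add_generator_apply_comm`, both printed equalities), the power laws
`e^{nF} = (e^{F})ⁿ` (`expOp_natCast`, `expOp_neg_natCast`) behind "`P^{−λ} = p(D)^λ`", and the uniqueness
of the generator (`expOp_one_injective`: `e^{F} = e^{G} ⇒ F = G`, "necessarily unique").

## References
* [RotaKahanerOdlyzko1973] G.-C. Rota, D. Kahaner, A. Odlyzko, *On the foundations of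
  combinatorial theory VIII. Finite operator calculus*, J. Math. Anal. Appl. 42 (1973) 684–760,
  §8 pp. 715–716 (generators, Proposition 6 (a)).
-/

noncomputable section

open Polynomial Finset

namespace Literature.Algebra.Polynomial

variable {K : Type*} [Field K] [CharZero K]

/-! ## Calculus in `K[[t]]`: `f′ = 0 ⇒ f` constant; uniqueness for `f′ = u f` -/

/-- In characteristic `0`, a power series with zero derivative is constant.
[cite: RotaKahanerOdlyzko1973, §8 (generators), p. 716] -/
theorem powerSeries_eq_C_of_derivative_eq_zero {q : PowerSeries K} (h : PowerSeries.derivative K q = 0) :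
    q = PowerSeries.C (PowerSeries.constantCoeff q) := by
  ext n
  cases n with
  | zero => rw [PowerSeries.coeff_zero_eq_constantCoeff, PowerSeries.constantCoeff_C]
  | succ n =>
    have hn := congrArg (PowerSeries.coeff n) h
    rw [PowerSeries.coeff_derivative, map_zero, mul_eq_zero] at hn
    rw [PowerSeries.coeff_C, if_neg (Nat.succ_ne_zero n)]
    exact hn.resolve_right (by exact_mod_cast Nat.succ_ne_zero n)

/-- **Uniqueness for the linear equation `f′ = u f`**: two solutions with `g (0) ≠ 0` and the same
constant term coincide (`(f/g)′ = 0`). [cite: RotaKahanerOdlyzko1973, §8 (generators), p. 716] -/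
theorem powerSeries_eq_of_derivative_eq_mul {f g u : PowerSeries K}
    (hf : PowerSeries.derivative K f = u * f) (hg : PowerSeries.derivative K g = u * g)
    (hg0 : PowerSeries.constantCoeff g ≠ 0) (h0 : PowerSeries.constantCoeff f = PowerSeries.constantCoeff g) :
    f = g := by
  have hq : PowerSeries.derivative K (f * g⁻¹) = 0 := by
    rw [Derivation.leibniz, PowerSeries.derivative_inv', hf, smul_eq_mul, smul_eq_mul, hg]
    have h1 := PowerSeries.mul_inv_cancel g hg0
    linear_combination (-(f * u * g⁻¹)) * h1
  have hc := powerSeries_eq_C_of_derivative_eq_zero hq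
  rw [map_mul, PowerSeries.constantCoeff_inv, h0, mul_inv_cancel₀ hg0, map_one] at hc
  have h := congrArg (· * g) hc
  simp only [mul_assoc, PowerSeries.inv_mul_cancel g hg0, mul_one, one_mul] at h
  exact h

/-- `(e^{A})′ = e^{A} A′` for `A (0) = 0`. [cite: RotaKahanerOdlyzko1973, §8 (generators), p. 716] -/
theorem derivative_exp_subst {A : PowerSeries K} (hA : PowerSeries.constantCoeff A = 0) :
    PowerSeries.derivative K ((PowerSeries.exp K).subst A) =
      (PowerSeries.exp K).subst A * PowerSeries.derivative K A := by
  rw [PowerSeries.derivative_subst (hg := PowerSeries.HasSubst.of_constantCoeff_zero' hA), PowerSeries.derivative_exp]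

/-- `e^{A} (0) = 1` for `A (0) = 0`. [cite: RotaKahanerOdlyzko1973, §8 (generators), p. 716] -/
theorem constantCoeff_exp_subst {A : PowerSeries K} (hA : PowerSeries.constantCoeff A = 0) :
    PowerSeries.constantCoeff ((PowerSeries.exp K).subst A : PowerSeries K) = 1 := by
  rw [powerSeries_constantCoeff_subst hA, PowerSeries.constantCoeff_exp]

/-- **The functional equation of the exponential under substitution**: `e^{A+B} = e^{A} e^{B}` for
`A, B ∈ tK[[t]]` (both sides solve `f′ = (A+B)′ f`, `f (0) = 1`).
[cite: RotaKahanerOdlyzko1973, §8 Proposition 6 (a), p. 716] -/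
theorem exp_subst_add {A B : PowerSeries K} (hA : PowerSeries.constantCoeff A = 0)
    (hB : PowerSeries.constantCoeff B = 0) :
    ((PowerSeries.exp K).subst (A + B) : PowerSeries K) = (PowerSeries.exp K).subst A * (PowerSeries.exp K).subst B := by
  have hAB : PowerSeries.constantCoeff (A + B) = 0 := by rw [map_add, hA, hB, add_zero]
  refine powerSeries_eq_of_derivative_eq_mul (u := PowerSeries.derivative K (A + B)) ?_ ?_ ?_ ?_
  · rw [derivative_exp_subst hAB, mul_comm]
  · rw [Derivation.leibniz, derivative_exp_subst hA, derivative_exp_subst hB, smul_eq_mul, smul_eq_mul, map_add]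
    ring
  · rw [map_mul, constantCoeff_exp_subst hA, constantCoeff_exp_subst hB, mul_one]
    exact one_ne_zero
  · rw [constantCoeff_exp_subst hAB, map_mul, constantCoeff_exp_subst hA, constantCoeff_exp_subst hB, mul_one]

/-- `e^{aF} = e^{s}|_{s = aF}`: the rescaled exponential composed with `F` is `exp ∘ (aF)`.
[cite: RotaKahanerOdlyzko1973, §8 (generators), p. 716] -/
theorem rescale_exp_subst_eq_exp_subst_smul (a : K) {F : PowerSeries K} (hF : PowerSeries.constantCoeff F = 0) :
    ((PowerSeries.rescale a (PowerSeries.exp K)).subst F : PowerSeries K) = (PowerSeries.exp K).subst (a • F) := by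
  have hs := PowerSeries.HasSubst.of_constantCoeff_zero' hF
  rw [PowerSeries.rescale_eq_subst, PowerSeries.subst_comp_subst_apply (PowerSeries.HasSubst.smul_X' a) hs,
    PowerSeries.subst_smul hs, PowerSeries.subst_X hs]

/-- **`e^{a(F+G)} = e^{aF} e^{aG}`** for generators `F, G` (`F (1) = G (1) = 0`).
[cite: RotaKahanerOdlyzko1973, §8 Proposition 6 (a), p. 716] -/
theorem rescale_exp_subst_add (a : K) {F G : PowerSeries K} (hF : PowerSeries.constantCoeff F = 0)
    (hG : PowerSeries.constantCoeff G = 0) :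
    ((PowerSeries.rescale a (PowerSeries.exp K)).subst (F + G) : PowerSeries K) =
      (PowerSeries.rescale a (PowerSeries.exp K)).subst F * (PowerSeries.rescale a (PowerSeries.exp K)).subst G := by
  have hFG : PowerSeries.constantCoeff (F + G) = 0 := by rw [map_add, hF, hG, add_zero]
  rw [rescale_exp_subst_eq_exp_subst_smul a hFG, rescale_exp_subst_eq_exp_subst_smul a hF,
    rescale_exp_subst_eq_exp_subst_smul a hG, smul_add,
    exp_subst_add (by rw [PowerSeries.smul_eq_C_mul, map_mul, hF, mul_zero])
      (by rw [PowerSeries.smul_eq_C_mul, map_mul, hG, mul_zero])]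

/-! ## Proposition 6 (a): generators add -/

section Generators

variable {F G : PowerSeries K}

/-- **`e^{a(F+G)}(D) = e^{aF}(D) e^{aG}(D)`**: the exponential group of `F + G` is the product of the
(commuting) groups of `F` and `G`. [cite: RotaKahanerOdlyzko1973, §8 Proposition 6 (a), p. 716] -/
theorem expOp_add_generator (hF : PowerSeries.constantCoeff F = 0) (hG : PowerSeries.constantCoeff G = 0) (a : K) :
    expOp (F + G) a = expOp F a ∘ₗ expOp G a := by
  rw [expOp_eq, expOp_eq, expOp_eq, ← diffOp_mul, rescale_exp_subst_add a hF hG]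

/-- The groups of two generators commute. [cite: RotaKahanerOdlyzko1973, §8 Proposition 6 (a), p. 716] -/
theorem expOp_comm (F G : PowerSeries K) (a b : K) : expOp F a ∘ₗ expOp G b = expOp G b ∘ₗ expOp F a :=
  (isShiftInvariant_expOp F a).comp_comm (isShiftInvariant_expOp G b)

/-- **Proposition 6 (a)**: for the cross-sequences `p_n^{[λ]} = e^{−λF} p_n` and `q_n^{[λ]} = e^{−λG} p_n` with
the same basic sequence, `e^{−λ(F+G)} p_n = e^{−λG} p_n^{[λ]} = e^{−λF} q_n^{[λ]}` — `F + G` generates this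
cross-sequence. [cite: RotaKahanerOdlyzko1973, §8 Proposition 6 (a), p. 716] -/
theorem expOp_add_generator_apply (hF : PowerSeries.constantCoeff F = 0) (hG : PowerSeries.constantCoeff G = 0)
    (a : K) (f : K[X]) :
    expOp (F + G) (-a) f = expOp G (-a) (expOp F (-a) f) ∧ expOp (F + G) (-a) f = expOp F (-a) (expOp G (-a) f) := by
  refine ⟨?_, ?_⟩
  · rw [expOp_add_generator hF hG, expOp_comm, LinearMap.comp_apply]
  · rw [expOp_add_generator hF hG, LinearMap.comp_apply]

/-- Proposition 6 (a), cross-sequence form: `λ ↦ e^{−λG} p_n^{[λ]}` (`p_n^{[λ]} = e^{−λF} p_n`, `p_n` of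
binomial type) is the cross-sequence generated by `F + G`.
[cite: RotaKahanerOdlyzko1973, §8 Proposition 6 (a), p. 716] -/
theorem isCrossSequence_expOp_expOp (hF : PowerSeries.constantCoeff F = 0) (hG : PowerSeries.constantCoeff G = 0)
    {p : ℕ → K[X]} (hp : IsBinomialType p) :
    IsCrossSequence fun a n => expOp G (-a) (expOp F (-a) (p n)) := by
  have h : (fun a n => expOp G (-a) (expOp F (-a) (p n))) = fun a n => expOp (F + G) (-a) (p n) :=
    funext fun a => funext fun n => ((expOp_add_generator_apply hF hG a (p n)).1).symm
  rw [h]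
  exact isCrossSequence_expOp_neg (by rw [map_add, hF, hG, add_zero]) hp

/-! ### `P^{−λ} = p(D)^λ`: the exponential group interpolates the integral powers -/

/-- `e^{nF}(D) = (e^{F}(D))ⁿ` for natural `n`. [cite: RotaKahanerOdlyzko1973, §8 (proof of Proposition 1:
"`P^{−λ} = p(D)^λ`"), p. 714] -/
theorem expOp_natCast (hF : PowerSeries.constantCoeff F = 0) (n : ℕ) : expOp F (n : K) = expOp F 1 ^ n := by
  induction n with
  | zero => rw [Nat.cast_zero, expOp_zero, pow_zero, Module.End.one_eq_id]
  | succ n ih => rw [Nat.cast_succ, expOp_add hF, ih, pow_succ, Module.End.mul_eq_comp]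

/-- `e^{−nF}(D) = (e^{−F}(D))ⁿ` for natural `n` (`P^{−n}` versus `P⁻¹`).
[cite: RotaKahanerOdlyzko1973, §8 (generators), p. 716] -/
theorem expOp_neg_natCast (hF : PowerSeries.constantCoeff F = 0) (n : ℕ) : expOp F (-(n : K)) = expOp F (-1) ^ n := by
  induction n with
  | zero => rw [Nat.cast_zero, neg_zero, expOp_zero, pow_zero, Module.End.one_eq_id]
  | succ n ih => rw [Nat.cast_succ, neg_add, expOp_add hF, ih, pow_succ, Module.End.mul_eq_comp]

/-- `e^{F}(D) e^{−F}(D) = I`: `P` and `P⁻¹`. [cite: RotaKahanerOdlyzko1973, §8 (generators), p. 716] -/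
theorem expOp_one_comp_expOp_neg_one (hF : PowerSeries.constantCoeff F = 0) :
    expOp F 1 ∘ₗ expOp F (-1) = LinearMap.id :=
  (isOneParameterGroup_expOp hF).comp_neg 1

/-! ### The generator is unique -/

/-- **"A necessarily unique cross-sequence" and conversely: the generator is determined by `P = e^{F}`**
— `e^{F}(D) = e^{G}(D)` for `F (0) = G (0) = 0` forces `F = G` (take logarithms:
`F = log (1 + (e^{F} − 1))`). [cite: RotaKahanerOdlyzko1973, §8 (generators), p. 716] -/
theorem expOp_one_injective (hF : PowerSeries.constantCoeff F = 0) (hG : PowerSeries.constantCoeff G = 0)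
    (h : expOp F 1 = expOp G 1) : F = G := by
  rw [expOp_eq, expOp_eq, PowerSeries.rescale_one, RingHom.id_apply] at h
  have h' := diffOp_injective h
  rw [← log_subst_exp_subst_sub_one hF, ← log_subst_exp_subst_sub_one hG, h']

/-- Hence the whole group determines the generator: `(∀ a, e^{aF}(D) = e^{aG}(D)) ⇒ F = G`.
[cite: RotaKahanerOdlyzko1973, §8 (generators), p. 716] -/
theorem expOp_injective (hF : PowerSeries.constantCoeff F = 0) (hG : PowerSeries.constantCoeff G = 0)
    (h : expOp F = expOp G) : F = G :=
  expOp_one_injective hF hG (congrFun h 1)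

end Generators

end Literature.Algebra.Polynomial
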